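import Summits.QuantumFields.BalabanUV.Beta.EriceFlowEnclosureB12AsPrintedPointwiseFadingZeroHistoryConstantsEnd

/-!
# Beta / EriceFlowEnclosureB12AsPrintedPointwiseFadingZeroHistoryConstantsTyped — WHAT (0.31) FORCES, part 14e: THE TYPED CONSTANTS AT ENDPOINT g.
# Part 14b read the g-UNIFORM constants of (0.31) on the zero-history values (`β ln L ≤ b⁰_k ≤ β′ ln L`) and the TYPED reading only through its sign consequence (`0 ≤ b⁰_k`).  THIS FILE gives
# the QUANTITATIVE statement for the typed reading ([I] p. 259 as typed in `Missing.B12Thm2Shape`: «for a sufficiently small positive g there exist constants β, β′» — constants β(g), β′(g)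
# depending on the endpoint):
#  §1 generic (`β : HBeta`, node U2's moduli, part 13's `b⁰`): ONE pinned run of depth k+1 inside ]0, γ] ending at `g ≤ γ` with the (0.31)-window `[B, B′]` (`B ≥ 0`) forces
#     **`B ≤ b⁰_k + Cg∕(1−θ)` and `b⁰_k − Cg∕(1−θ) ≤ B′`** (`window_le_zeroHist_add_of_pinnedRun`): its prefix lies in ]0, g]^{k+1} (the lower (0.31) makes the run increase towards g) where
#     `|β_{k+1} − b⁰_k| ≤ Cg∕(1−θ)`.
#  §2 carrier: **`typedConstants_window`** — `Theorem2Statement S hL` AS TYPED + `hrg` + moduli ⟹ for every m there are γ₀ and, for each box `γ ≤ min(γ₀, γ_U)`, a threshold g₁ such that for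
#     EVERY endpoint `g ≤ g₁` the constants `0 < β(g) ≤ β′(g)` the typed Theorem 2 delivers obey **`β(g) ln L ≤ b⁰_k + Cg∕(1−θ)` and `b⁰_k − Cg∕(1−θ) ≤ β′(g) ln L` for EVERY k**: the
#     endpoint-dependent constants are enclosed by the intrinsic one-loop coefficients up to `O(g)` (so `limsup_{g→0⁺} β(g) ln L ≤ ⨅_k b⁰_k ≤ ⨆_k b⁰_k ≤ liminf_{g→0⁺} β′(g) ln L`, stated as
#     the displayed inequalities); **`typedLowerConstant_le_linear_on_face`** — ON THE FACE (`b⁰_{k₀} = 0` for some k₀) print's lower constant DEGENERATES LINEARLY: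
#     **`β(g) ln L ≤ Cg∕(1−θ)`** for every small endpoint g — the quantitative form of part 14b §4 (typed-but-not-uniform families have `β(g) → 0`); and conversely
#     `zeroHist_pos_of_typedLowerConstant` — a typed lower constant with `β(g) ln L > Cg∕(1−θ)` at ONE small endpoint certifies `b⁰_k > 0` at EVERY scale.
# (β-flow team, prover 2 = lower ∕ positivity side, unit `b2b-balaban-beta-bflow-p2`, gen 52; ROW AP-I × node U2's letters; part 14e)

HONEST FRAMING (page 1 of everything the β sub-cell writes): discharging `BetaPertH` makes Bałaban's UV stability UNCONDITIONAL — a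
real constructive-QFT result; it is NOT the continuum limit and NOT the Clay problem.  HONEST DEPENDENCY (cell reorg 2026-08-19,
verbatim): «continuum YM on T⁴ ⇐ BetaPertH ∧ nine spine estimates (0/9 proved); BetaPertH ⇐ (D1) ∧ (D4) ∧ CAP+tail; G-an2-4 gates
asym, D1 and NE2/3/4.»  THIS MODULE DISCHARGES NOTHING: [folklore] finite bookkeeping for an ABSTRACT `β : FlowStep.HBeta` under node U2's HYPOTHESIS SHAPES `HistLipschitz ∕ FadingMemory`
(NONE printed; GAPS G-t4-U2-1 ∕ 2) over part 13's `abs_sub_zeroHist_le_box` and part 14's `lastWindow_of_runH` ∕ `le_end_of_discrete031H`; on the carrier the statement-exact typing `B12BetaAsPrinted`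
(`Theorem2Statement` — STATED WITHOUT PROOF in print, p. 259 — a HYPOTHESIS), prover 1's binder `hrg`, part 1's `tunedRuns_of_theorem2Statement` ∕ `prefixOf_mem_box_of_inInterval` BY NAME.  `b⁰`
carries a DISPLAYED property; no definition.  Nothing of Bałaban's (1.22), its constants β, β′ or its one-loop coefficients is asserted.

WHAT THIS FILE PROVES (0 sorry, 0 def):
§1 `prefix_mem_box_endpoint`, **`window_le_zeroHist_add_of_pinnedRun`**.
§2 **`typedConstants_window`**, **`typedLowerConstant_le_linear_on_face`**, `zeroHist_pos_of_typedLowerConstant`.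
NOT CLAIMED: the value of Bałaban's constants or coefficients; which reading print intends; Theorem 2; `BetaPertH`; continuum; Clay.
-/

namespace Summit.QuantumFields.BalabanUV.Beta.EriceFlowEnclosureB12AsPrintedPointwiseFadingZeroHistoryConstantsTyped

open Finset Filter Topology
open Literature.MathematicalPhysics.QuantumFieldTheory.Balaban1983to89
open Literature.MathematicalPhysics.QuantumFieldTheory.Balaban1983to89.B12BetaAsPrinted
open Literature.MathematicalPhysics.QuantumFieldTheory.Balaban1983to89.FlowStep (HBeta prefixOf Box mem_box box_mono RGEqH BetaLowerH BetaUpperH)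
open Literature.MathematicalPhysics.QuantumFieldTheory.Balaban1983to89.T4CouplingMatching (HistLipschitz FadingMemory ScaleShiftRate)
open Summit.QuantumFields.BalabanUV.Beta.EriceFlowEnclosureB12AsPrintedUpper (tunedRuns_of_theorem2Statement)
open Summit.QuantumFields.BalabanUV.Beta.EriceFlowEnclosureB12AsPrintedTunedUpper (prefixOf_mem_box_of_inInterval)
open Summit.QuantumFields.BalabanUV.Beta.EriceFlowEnclosureB12AsPrintedPointwiseFadingZeroHistory
open Summit.QuantumFields.BalabanUV.Beta.EriceFlowEnclosureB12AsPrintedPointwiseFadingZeroHistoryConstants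

noncomputable section

/-! ## §1 Generic: one pinned run at endpoint g reads `b⁰_k` up to `Cg∕(1−θ)` -/

section Generic

variable {β : HBeta} {γ C θ : ℝ} {Λ : ℕ → ℕ → ℝ}

/-- The prefix of a positive run carrying the lower (0.31)-window with a constant `B ≥ 0` and ending at `r_{k+1} = g` lies in the box ]0, g]^{k+1} (every coupling is below the endpoint,
part 14's `le_end_of_discrete031H`). [cite: Balaban1987RG1, (0.31) p.259] -/
theorem prefix_mem_box_endpoint {B B' g : ℝ} {k : ℕ} {r : ℕ → ℝ} (hB : 0 ≤ B) (hpos : ∀ i, i ≤ k + 1 → 0 < r i)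
    (hend : r (k + 1) = g) (hD : Step.Discrete031 B B' (k + 1) (r (k + 1)) r) : prefixOf r k ∈ Box g k :=
  mem_box.mpr fun i => ⟨hpos i i.isLt.le, hend ▸ le_end_of_discrete031H hB hpos hD (i := (i : ℕ)) i.isLt.le⟩

/-- **ONE PINNED RUN READS `b⁰_k` UP TO `Cg∕(1−θ)`.**  Under node U2's moduli on ]0, γ] with part 13's zero-history values `b⁰`: a run `r` of (0.20) of depth k+1, positive, ending at
`r_{k+1} = g ∈ ]0, γ]`, with the (0.31)-window `Step.Discrete031 B B′ (k+1) g r` (`B ≥ 0`) forces **`B ≤ b⁰_k + Cg∕(1−θ)` and `b⁰_k − Cg∕(1−θ) ≤ B′`**: the last window gives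
`B ≤ β_{k+1}(r_{≤k}) ≤ B′` at a history inside ]0, g]^{k+1}, where `|β_{k+1} − b⁰_k| ≤ Cg∕(1−θ)` (part 13's `abs_sub_zeroHist_le_box`).  Part 14's `zeroHist_window_of_pinnedRuns` is the
limit `g → 0⁺` of this. [cite: Balaban1987RG1, Thm 2 (0.31) p.259 with (0.20) p.256 and (2.12) p.268] -/
theorem window_le_zeroHist_add_of_pinnedRun (hL : HistLipschitz Λ γ β) (hΛ : FadingMemory C θ Λ) (hθ0 : 0 ≤ θ) (hθ1 : θ < 1) (hC : 0 ≤ C)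
    (hγ : 0 < γ) {b0 : ℕ → ℝ}
    (hb0 : ∀ (k : ℕ) (u : ℝ), 0 < u → u ≤ γ → |β k (fun _ : Fin (k + 1) => u) - b0 k| ≤ C * u / (1 - θ))
    {k : ℕ} {B B' g : ℝ} {r : ℕ → ℝ} (hB : 0 ≤ B) (hg : 0 < g) (hgγ : g ≤ γ) (hrg : RGEqH (k + 1) β r)
    (hpos : ∀ i, i ≤ k + 1 → 0 < r i) (hend : r (k + 1) = g) (hD : Step.Discrete031 B B' (k + 1) g r) :
    B ≤ b0 k + C * g / (1 - θ) ∧ b0 k - C * g / (1 - θ) ≤ B' := by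
  rw [← hend] at hD
  obtain ⟨hlo, hhi⟩ := lastWindow_of_runH hrg hD
  have hbox : prefixOf r k ∈ Box g k := prefix_mem_box_endpoint hB hpos hend hD
  have h := abs_le.mp (abs_sub_zeroHist_le_box hL hΛ hθ0 hθ1 hC hγ hb0 hg hgγ hbox)
  exact ⟨by linarith [h.2], by linarith [h.1]⟩

end Generic

/-! ## §2 On the carrier: the typed constants β(g), β′(g) are enclosed by the one-loop coefficients up to O(g) -/

section Carrier

variable {S : Setting}

/-- **THE TYPED CONSTANTS AT ENDPOINT g ARE ENCLOSED BY THE ONE-LOOP COEFFICIENTS UP TO `Cg∕(1−θ)`.**  `Theorem2Statement S hL` AS TYPED + prover 1's `hrg` on ]0, γ_U] + node U2's moduli on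
]0, γ_U] + part 13's `b⁰` ⟹ for every torus exponent m there is γ₀ > 0 such that for every box `0 < γ ≤ min(γ₀, γ_U)` there is g₁ > 0 such that for EVERY endpoint `0 < g ≤ g₁` the typed
Theorem 2 delivers constants `0 < β ≤ β′` — WITH its displayed run family in ]0, γ] pinned at g — satisfying **`β ln L ≤ b⁰_k + Cg∕(1−θ)` and `b⁰_k − Cg∕(1−θ) ≤ β′ ln L` for every k**.
So the endpoint-dependent constants of p. 259, whatever print intends them to be, are squeezed by the intrinsic coefficients as g → 0⁺; part 14b's `zeroHist_nonneg_of_typedTheorem2` is the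
sign consequence. [cite: Balaban1987RG1, Thm 2 (0.31) p.259 with (0.20) p.256 and (2.12) p.268] -/
theorem typedConstants_window {hL : Odd S.L ∧ 1 < S.L} (hT : Theorem2Statement S hL) (m : ℕ)
    {γU C θ : ℝ} {Λ : ℕ → ℕ → ℝ} (hγU : 0 < γU) (hθ0 : 0 ≤ θ) (hθ1 : θ < 1) (hC : 0 ≤ C)
    (hrg : ∀ P : B12.RunParams, Step.InInterval γU P.K (S.cpl P) → RGEqH P.K S.β (S.cpl P))
    (hLip : HistLipschitz Λ γU S.β) (hΛ : FadingMemory C θ Λ) {b0 : ℕ → ℝ}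
    (hb0 : ∀ (k : ℕ) (u : ℝ), 0 < u → u ≤ γU → |S.β k (fun _ : Fin (k + 1) => u) - b0 k| ≤ C * u / (1 - θ)) :
    ∃ γ₀ : ℝ, 0 < γ₀ ∧ ∀ γ : ℝ, 0 < γ → γ ≤ min γ₀ γU → ∃ g₁ : ℝ, 0 < g₁ ∧ ∀ g : ℝ, 0 < g → g ≤ g₁ →
      ∃ β β' : ℝ, 0 < β ∧ β ≤ β' ∧
        (∀ K : ℕ, ∃ g₀ : ℝ, Step.InInterval γ K (S.cpl ⟨K, m, g₀⟩) ∧ S.cpl ⟨K, m, g₀⟩ K = g ∧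
          Step.Discrete031 (β * Real.log S.L) (β' * Real.log S.L) K g (S.cpl ⟨K, m, g₀⟩)) ∧
        ∀ k : ℕ, β * Real.log S.L ≤ b0 k + C * g / (1 - θ) ∧ b0 k - C * g / (1 - θ) ≤ β' * Real.log S.L := by
  have hlog : 0 < Real.log (S.L : ℝ) := Real.log_pos (by exact_mod_cast hL.2)
  obtain ⟨γ₀, hγ₀, hγ⟩ := tunedRuns_of_theorem2Statement hT m
  refine ⟨γ₀, hγ₀, fun γ hγpos hγle => ?_⟩
  obtain ⟨g₁, hg₁, hg⟩ := hγ γ hγpos (hγle.trans (min_le_left _ _))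
  refine ⟨min g₁ γ, lt_min hg₁ hγpos, fun g hgpos hgle => ?_⟩
  obtain ⟨β, β', hβ, hββ', hK⟩ := hg g hgpos (hgle.trans (min_le_left _ _))
  refine ⟨β, β', hβ, hββ', hK, fun k => ?_⟩
  obtain ⟨g₀, hI, hend, hD⟩ := hK (k + 1)
  have hγU' : γ ≤ γU := hγle.trans (min_le_right _ _)
  have hIU : Step.InInterval γU (k + 1) (S.cpl ⟨k + 1, m, g₀⟩) := fun i hi => ⟨(hI i hi).1, (hI i hi).2.trans hγU'⟩
  exact window_le_zeroHist_add_of_pinnedRun hLip hΛ hθ0 hθ1 hC hγU hb0 (mul_pos hβ hlog).le hgpos ((hgle.trans (min_le_right _ _)).trans hγU')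
    (hrg ⟨k + 1, m, g₀⟩ hIU) (fun i hi => (hI i hi).1) hend hD

/-- **ON THE FACE PRINT's LOWER CONSTANT DEGENERATES LINEARLY.**  Same hypotheses; if SOME zero-history value vanishes (`b⁰_{k₀} = 0` — part 14b §4's face, e.g. part 8a's ramp), then for every
m, every small box and EVERY small endpoint g, ANY constants `β(g) ≤ β′(g)` with which the typed Theorem 2 holds at g obey **`β(g) ln L ≤ Cg∕(1−θ)`** — the lower constant of (0.31) is
`O(g)` as g → 0⁺; in particular no g-uniform positive constant exists (part 14b `exists_zeroHist_eq_zero_of_typed_not_uniform`, quantified). [cite: Balaban1987RG1, Thm 2 (0.31) p.259 with (2.12) p.268] -/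
theorem typedLowerConstant_le_linear_on_face {hL : Odd S.L ∧ 1 < S.L} (hT : Theorem2Statement S hL) (m : ℕ)
    {γU C θ : ℝ} {Λ : ℕ → ℕ → ℝ} (hγU : 0 < γU) (hθ0 : 0 ≤ θ) (hθ1 : θ < 1) (hC : 0 ≤ C)
    (hrg : ∀ P : B12.RunParams, Step.InInterval γU P.K (S.cpl P) → RGEqH P.K S.β (S.cpl P))
    (hLip : HistLipschitz Λ γU S.β) (hΛ : FadingMemory C θ Λ) {b0 : ℕ → ℝ}
    (hb0 : ∀ (k : ℕ) (u : ℝ), 0 < u → u ≤ γU → |S.β k (fun _ : Fin (k + 1) => u) - b0 k| ≤ C * u / (1 - θ)) {k₀ : ℕ} (hface : b0 k₀ = 0) :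
    ∃ γ₀ : ℝ, 0 < γ₀ ∧ ∀ γ : ℝ, 0 < γ → γ ≤ min γ₀ γU → ∃ g₁ : ℝ, 0 < g₁ ∧ ∀ g : ℝ, 0 < g → g ≤ g₁ →
      ∃ β β' : ℝ, 0 < β ∧ β ≤ β' ∧
        (∀ K : ℕ, ∃ g₀ : ℝ, Step.InInterval γ K (S.cpl ⟨K, m, g₀⟩) ∧ S.cpl ⟨K, m, g₀⟩ K = g ∧
          Step.Discrete031 (β * Real.log S.L) (β' * Real.log S.L) K g (S.cpl ⟨K, m, g₀⟩)) ∧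
        β * Real.log S.L ≤ C * g / (1 - θ) := by
  obtain ⟨γ₀, hγ₀, hγ⟩ := typedConstants_window hT m hγU hθ0 hθ1 hC hrg hLip hΛ hb0
  refine ⟨γ₀, hγ₀, fun γ hγpos hγle => ?_⟩
  obtain ⟨g₁, hg₁, hg⟩ := hγ γ hγpos hγle
  refine ⟨g₁, hg₁, fun g hgpos hgle => ?_⟩
  obtain ⟨β, β', hβ, hββ', hK, hwin⟩ := hg g hgpos hgle
  refine ⟨β, β', hβ, hββ', hK, ?_⟩
  have h := (hwin k₀).1
  rw [hface, zero_add] at h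
  exact h

/-- **CONVERSELY, ONE GOOD ENDPOINT CERTIFIES EVERY ONE-LOOP SIGN.**  Under the moduli: if at ONE endpoint `g ∈ ]0, γ_U]` and at every depth `K = k+1` some run of (0.20) inside ]0, γ_U] ends at g
with a lower (0.31)-constant `B` exceeding the history allowance, `Cg∕(1−θ) < B`, then `0 < b⁰_k` at EVERY scale (`b⁰_k ≥ B − Cg∕(1−θ) > 0`) — a finite-g certificate for the face question. [cite: Balaban1987RG1, Thm 2 (0.31) p.259 with (2.12) p.268] -/
theorem zeroHist_pos_of_typedLowerConstant {γU C θ : ℝ} {Λ : ℕ → ℕ → ℝ} (hγU : 0 < γU) (hθ0 : 0 ≤ θ) (hθ1 : θ < 1) (hC : 0 ≤ C)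
    (hLip : HistLipschitz Λ γU S.β) (hΛ : FadingMemory C θ Λ) {b0 : ℕ → ℝ}
    (hb0 : ∀ (k : ℕ) (u : ℝ), 0 < u → u ≤ γU → |S.β k (fun _ : Fin (k + 1) => u) - b0 k| ≤ C * u / (1 - θ))
    {B B' g : ℝ} (hg : 0 < g) (hgγ : g ≤ γU) (hBg : C * g / (1 - θ) < B)
    (hruns : ∀ k : ℕ, ∃ r : ℕ → ℝ, RGEqH (k + 1) S.β r ∧ Step.InInterval γU (k + 1) r ∧ r (k + 1) = g ∧ Step.Discrete031 B B' (k + 1) g r)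
    (k : ℕ) : 0 < b0 k := by
  have h1θ : 0 < 1 - θ := by linarith
  have hB : 0 ≤ B := le_trans (by positivity) hBg.le
  obtain ⟨r, hrg, hI, hend, hD⟩ := hruns k
  have h := (window_le_zeroHist_add_of_pinnedRun hLip hΛ hθ0 hθ1 hC hγU hb0 hB hg hgγ hrg (fun i hi => (hI i hi).1) hend hD).1
  linarith

end Carrier

end

end Summit.QuantumFields.BalabanUV.Beta.EriceFlowEnclosureB12AsPrintedPointwiseFadingZeroHistoryConstantsTyped
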